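import Summits.BirchSwinnertonDyer.BirchSwinnertonDyer.Theorems.GoldfeldAllTwistsTwoConverseTwinHalfTraceSevenModEightPartner
import Summits.BirchSwinnertonDyer.BirchSwinnertonDyer.Theorems.GoldfeldAllTwistsTwoConverseTwinQuarterTraceTorsion
import Summits.BirchSwinnertonDyer.BirchSwinnertonDyer.Theorems.GoldfeldAllTwistsTwoConverseTwinGenusHeightRatioNegTwo
import Literature.NumberTheory.QuadraticFields.DiscriminantOfSqrt
import Literature.NumberTheory.EllipticCurves.HeegnerPointsShimuraReciprocityHoldsProofs
import HarnessLib

set_option linter.dupNamespace false -- namespace `…BirchSwinnertonDyer.BirchSwinnertonDyer…` is the cell's (D-0017 nested layout)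
set_option autoImplicit false

/-!
# LINE C3⁺ (PHASE 2), file P2d-1: the `χ_p` partner point `Y₂ = y_{ℚ(√−2q)} ∈ X₀(49)(K[1])`, `K = ℚ(√−2qp)` —
# Birch's relation with EVEN class number: `Y₂ + tY₂ = O` for every `t` with `t√−2q = −√−2q`

Cell `bsd-goldfeld`, seat `bsd-goldfeld-s1p-c3x` (gen 7); planner ORDER (ccxxix)/(ccxxxi) «LINE C3⁺», tranche 2, file P2d (the `χ_p`
partner), point half (the height half is P2d-2 `…TwinQuarterTracePartnerPHeight`). `--supports stmt-BirchSwinnertonDyer-20044` as a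
HELPER. Theses-free; theorems only; no definition, no `sorry`, NO new fact: the two named inputs are A″'s — `w(49a1) = +1` (`hw`) and the
cusp value `φ₀(0) = T` (`h0`) — everything else is proved in the tree and cited (A″ `map_cm7_heegnerPoint_conj_add_eq_card_smul`,
ty's Shimura-reciprocity bijection `heegnerFormClass_bijective`, genus counting `index_range_sq_classGroup_QO`).

CONTENT. §1 `s = √−2q ∈ K[1]`: the field `K₂ = ℚ⟮s⟯ ⊂ K[1]` is imaginary quadratic of discriminant `−8q` (Marcus Ch. 2 Thm 1, tree
`discr_eq_four_mul_of_sq_eq_intCast`), satisfies the Heegner hypothesis for `49` (`(−8q/7) = +1` from `(q/7) = −1`), and has EVEN class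
number (`[C : C²] = 2`, two assigned characters); `s` itself is built from `√d_K ∈ K` and `r_p = √p ∈ K[1]` (`s·r_p = √d_K/2 ∈ K`), so every
`σ ∈ Gal(K[1]/K)` moves `s` exactly as it moves `r_p`, and complex conjugation negates `s`. §2 THE PARTNER POINT (A″'s
`exists_partnerPoint_negEightPrime` with odd ↦ even): a Heegner datum `H₂`, a point `P₂ ∈ X₀(49)(K₂)` over the Heegner point of `(D₀, H₂)`,
`Y₂ := P₂ ∈ X₀(49)(K[1])` FIXED by every `ℚ`-algebra map fixing `s` and with **`Y₂ + tY₂ = O`** for every one negating `s` (Birch: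
`ι(σP₂ + P₂) = h(−8q)·φ(0) = h(−8q)·T = O`). So `Y₂` is a `χ_p`-point of `X₀(49)(K[1])` negated by complex conjugation — the hypotheses
`hY : cY + Y = 0·T`, (H4) of the quarter-trace assembly for `χ_p` (type β: `ε_p = 0`). HONEST FRAMING: Heegner-point bookkeeping; no
`L`-value; no case of K12₂″ / twin″ decided; BSD is not proved by any of this.

References: [Gross1984] §5 (5.2)–(5.3); [GrossLMS1991] Prop. 5.3; [Darmon2004] Thm. 3.6, Prop. 3.11; [Cox2013] §3.B Thm. 3.15, §7.B Thm. 7.7;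
[Marcus2018] Ch. 2 Thm. 1. -/

noncomputable section

open scoped Classical IntermediateField

open WeierstrassCurve Literature.NumberTheory.EllipticCurves Literature.NumberTheory.EllipticCurves.ModularForms
  Literature.Computability.Cryptography.Hallgren2005
open Literature.NumberTheory.QuadraticFields.Quadratic (index_range_sq_classGroup_QO)
open Literature.NumberTheory.QuadraticFields.BinaryQuadraticForm (assignedCharCount_neg_four_mul_of_mod_four_eq_two)

namespace Summit.BirchSwinnertonDyer.BirchSwinnertonDyer.Theorems.GoldfeldGoodTwists

/-! ## §1 The field `ℚ(√−2q) ⊂ K[1]` -/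

section Field

/-- `−2q` is not a square in `ℚ`. [folklore] -/
theorem not_isSquare_neg_two_mul_natCast_rat {q : ℕ} (hq : q.Prime) : ¬ IsSquare (-(2 * (q : ℚ))) := by
  rintro ⟨b, hb⟩
  have : (0 : ℚ) < q := by exact_mod_cast hq.pos
  nlinarith [mul_self_nonneg b]

/-- A complex number with `z² = −m`, `m > 0` real, is purely imaginary: `conj z = −z`. [folklore] -/
theorem conj_eq_neg_of_sq_eq_neg_of_pos {z : ℂ} {m : ℝ} (hm : 0 < m) (hz : z ^ 2 = -(m : ℂ)) :
    starRingEnd ℂ z = -z := by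
  have hsq : (starRingEnd ℂ z) ^ 2 = z ^ 2 := by rw [← map_pow, hz, map_neg, Complex.conj_ofReal]
  rcases sq_eq_sq_iff_eq_or_eq_neg.mp hsq with h | h
  · exfalso
    have hre : (z.re : ℂ) = z := Complex.conj_eq_iff_re.mp h
    have h1 : ((z.re ^ 2 : ℝ) : ℂ) = -(m : ℂ) := by push_cast; rw [hre, hz]
    have h2 : (z.re ^ 2 : ℝ) = -m := by exact_mod_cast h1
    nlinarith [sq_nonneg z.re]
  · exact h

variable {K : Type} [Field K] [NumberField K] (ι : K →+* ℂ)

/-- **`√−2q ∈ K[1]`** for `d_K = −8qp`, built from `√d_K ∈ K` and `r_p = √p ∈ K[1]`: `s := √d_K/(2r_p)` has `s² = −2q` and `s·r_p ∈ K`.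
[cite: Cox2013, §6.A Thm. 6.1] -/
theorem exists_sqrt_neg_two_mul_of_sqrt (hK : IsImaginaryQuadratic K) {q p : ℕ} (hp : p.Prime)
    (hdK : NumberField.discr K = -(8 * (q : ℤ) * p)) {rp : ringClassField K ι 1} (hrp : (rp : ℂ) ^ 2 = (p : ℂ)) :
    ∃ (s : ringClassField K ι 1) (κ : K), (s : ℂ) ^ 2 = -(2 * (q : ℂ)) ∧ s * rp = algebraMap K (ringClassField K ι 1) κ := by
  obtain ⟨δ, hδ, -, -⟩ := exists_sq_eq_discr_and_span hK
  have hp0 : (rp : ℂ) ≠ 0 := by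
    intro h; rw [h, zero_pow two_ne_zero] at hrp
    exact (Nat.cast_ne_zero.mpr hp.ne_zero : (p : ℂ) ≠ 0) hrp.symm
  have hrp0 : rp ≠ 0 := fun h ↦ hp0 (by rw [h]; rfl)
  have hδC : (ι δ) ^ 2 = -(8 * (q : ℂ) * p) := by
    have h := congrArg ι hδ
    rw [map_pow] at h
    rw [h, hdK, eq_ratCast, map_ratCast]
    push_cast
    ring
  refine ⟨algebraMap K (ringClassField K ι 1) (δ / 2) * rp⁻¹, δ / 2, ?_, by rw [mul_assoc, inv_mul_cancel₀ hrp0, mul_one]⟩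
  have hp0' : (p : ℂ) ≠ 0 := by exact_mod_cast hp.ne_zero
  push_cast
  rw [mul_pow, div_pow, inv_pow, coe_algebraMap_ringClassField, coe_algebraMap_ringClassField, map_ofNat, hδC, hrp]
  field_simp
  ring

omit [NumberField K] in
/-- If `s·r ∈ K` and `r ≠ 0`, a `K`-automorphism fixing `r` fixes `s`, and one negating `r` negates `s`. [folklore] -/
theorem apply_sqrt_partner_of_mul_eq {L : Type*} [Field L] [Algebra K L] {s r : L} {κ : K} (hsr : s * r = algebraMap K L κ)
    (hr : r ≠ 0) (σ : L ≃ₐ[K] L) : (σ r = r → σ s = s) ∧ (σ r = -r → σ s = -s) := by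
  have h : σ s * σ r = s * r := by rw [← map_mul, hsr, AlgEquiv.commutes]
  constructor
  · intro hσ
    rw [hσ] at h
    exact mul_right_cancel₀ hr h
  · intro hσ
    rw [hσ, mul_neg, ← neg_mul] at h
    exact neg_eq_iff_eq_neg.mp (mul_right_cancel₀ hr h)

/-- `s² = −2q` read in `K[1]` over `ℚ`. [folklore] -/
theorem sq_eq_algebraMap_neg_two_mul_of_coe_sq {q : ℕ} {s : ringClassField K ι 1} (hs : (s : ℂ) ^ 2 = -(2 * (q : ℂ))) :
    s ^ 2 = algebraMap ℚ (ringClassField K ι 1) (-(2 * (q : ℚ))) := by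
  apply Subtype.ext
  rw [map_neg, map_mul, map_natCast, map_ofNat]
  push_cast
  exact hs

/-- `[ℚ⟮s⟯ : ℚ] = 2` for `s² = −2q`. [folklore] -/
theorem finrank_adjoin_sqrt_neg_two_mul [NumberField (ringClassField K ι 1)] {q : ℕ} (hq : q.Prime) {s : ringClassField K ι 1}
    (hs : (s : ℂ) ^ 2 = -(2 * (q : ℂ))) : Module.finrank ℚ ℚ⟮s⟯ = 2 :=
  finrank_adjoin_sqrt_eq_two (k := ℚ) (sq_eq_algebraMap_neg_two_mul_of_coe_sq ι hs) (not_isSquare_neg_two_mul_natCast_rat hq)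

/-- The generator `s ∈ ℚ⟮s⟯` squares to `−2q`. [folklore] -/
theorem adjoinGen_sq_neg_two_mul {q : ℕ} {s : ringClassField K ι 1} (hs : (s : ℂ) ^ 2 = -(2 * (q : ℂ))) :
    (⟨s, IntermediateField.mem_adjoin_simple_self ℚ s⟩ : ℚ⟮s⟯) ^ 2 =
      algebraMap ℚ (ℚ⟮s⟯ : IntermediateField ℚ (ringClassField K ι 1)) (-(2 * (q : ℚ))) := by
  apply Subtype.ext
  apply Subtype.ext
  rw [map_neg, map_mul, map_natCast, map_ofNat]
  push_cast
  exact hs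

/-- `ℚ⟮s⟯` is imaginary quadratic. [cite: Cox2013, §5.B (p. 119)] -/
theorem isImaginaryQuadratic_adjoin_sqrt_neg_two_mul [NumberField (ringClassField K ι 1)] {q : ℕ} (hq : q.Prime)
    {s : ringClassField K ι 1} (hs : (s : ℂ) ^ 2 = -(2 * (q : ℂ))) :
    IsImaginaryQuadratic (ℚ⟮s⟯ : IntermediateField ℚ (ringClassField K ι 1)) :=
  IsImaginaryQuadratic.of_sq_eq (finrank_adjoin_sqrt_neg_two_mul ι hq hs) (adjoinGen_sq_neg_two_mul ι hs)
    (by have : (0 : ℚ) < q := by exact_mod_cast hq.pos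
        linarith)

/-- `d(ℚ⟮s⟯) = −8q` (`−2q ≡ 2 (mod 4)` square-free: Marcus Ch. 2 Thm. 1). [cite: Marcus2018, Ch. 2 Thm. 1] [cite: Cox2013, (2.21)] -/
theorem discr_adjoin_sqrt_neg_two_mul [NumberField (ringClassField K ι 1)] {q : ℕ} (hq : q.Prime) (hq2 : q ≠ 2)
    {s : ringClassField K ι 1} (hs : (s : ℂ) ^ 2 = -(2 * (q : ℂ))) :
    NumberField.discr (ℚ⟮s⟯ : IntermediateField ℚ (ringClassField K ι 1)) = -(8 * (q : ℤ)) := by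
  have h2q : ¬ 2 ∣ q := fun h ↦ hq2 ((Nat.prime_dvd_prime_iff_eq Nat.prime_two hq).mp h).symm
  have hsq : Squarefree (2 * (q : ℤ)) := by
    exact_mod_cast Int.squarefree_natCast.mpr
      ((Nat.squarefree_mul ((Nat.prime_two.coprime_iff_not_dvd).mpr h2q)).mpr ⟨Nat.squarefree_two, hq.squarefree⟩)
  have h := Literature.NumberTheory.QuadraticFields.Quadratic.discr_eq_four_mul_of_sq_eq_intCast
    (finrank_adjoin_sqrt_neg_two_mul ι hq hs) (θ := ⟨s, IntermediateField.mem_adjoin_simple_self ℚ s⟩) (m := -(2 * (q : ℤ)))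
    (by rw [adjoinGen_sq_neg_two_mul ι hs, map_neg, map_mul, map_natCast, map_ofNat]; push_cast; ring)
    (Or.inl (by omega)) (hsq.squarefree_of_dvd (neg_dvd.mpr dvd_rfl))
  rw [h]; ring

/-- `7` splits in `ℚ(√−2q)` when `(q/7) = −1`: the Heegner hypothesis for `49`. [cite: Gross1984, §3 (Heegner hypothesis)] -/
theorem satisfiesHeegnerHypothesis_adjoin_sqrt_neg_two_mul [NumberField (ringClassField K ι 1)] {q : ℕ} (hq : q.Prime)
    (hq2 : q ≠ 2) (hq7 : jacobiSym q 7 = -1) {s : ringClassField K ι 1} (hs : (s : ℂ) ^ 2 = -(2 * (q : ℂ))) {N : ℕ}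
    (hN : cm7.conductorNorm ℤ = N) :
    SatisfiesHeegnerHypothesis N (ℚ⟮s⟯ : IntermediateField ℚ (ringClassField K ι 1)) := by
  subst hN
  rw [conductorNorm_cm7]
  exact satisfiesHeegnerHypothesis_fortyNine_negEightMul (isImaginaryQuadratic_adjoin_sqrt_neg_two_mul ι hq hs) hq7
    (discr_adjoin_sqrt_neg_two_mul ι hq hq2 hs)

end Field

/-! ## §2 Even class number `h(−8q)` and the partner point -/

section Partner

/-- **`h(−8q)` is even**, read on Gross's representatives: `#H.reps = #C(𝒪_{−8q})` (Shimura reciprocity bijection `Q ↦ [𝔞_Q]`) and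
`[C : C²] = 2` (two assigned characters). [cite: Cox2013, §3.B Thm. 3.15 and §7.B Thm. 7.7 (ii)] [cite: Gross1984, §I.1] -/
theorem even_card_reps_of_discr_negEightPrime {F : Type} [Field F] [NumberField F] (hF : IsImaginaryQuadratic F) {q : ℕ}
    (hq : q.Prime) (hq2 : q ≠ 2) (hdF : NumberField.discr F = -(8 * (q : ℤ))) {N : ℕ} [NeZero N] {W : WeierstrassCurve ℚ}
    [W.IsElliptic] (hH : SatisfiesHeegnerHypothesis N F) (Dt : ModularParametrizationData W N)
    (H : HeegnerDatum N (NumberField.discr F)) (ιF : F →+* ℂ) : Even H.reps.card := by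
  have hbij := heegnerPoints_shimuraReciprocity.heegnerFormClass_bijective
    (heegnerPoints_shimuraReciprocity_holds N W F) hF hH Dt H ιF
  haveI : Finite (ClassGroup (OrderCl.QO hF.negDiscr)) := Finite.of_surjective _ hbij.2
  have hcard : H.reps.card = Nat.card (ClassGroup (OrderCl.QO hF.negDiscr)) := by
    rw [← Fintype.card_coe, ← Nat.card_eq_fintype_card]
    exact Nat.card_eq_of_bijective _ hbij
  have hqodd : q % 2 = 1 := Nat.odd_iff.mp (hq.odd_of_ne_two hq2)
  have hD4 : hF.negDiscr.D % 4 = 0 ∨ hF.negDiscr.D % 4 = 1 := Or.inl (by rw [hF.negDiscr_D, hdF]; omega)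
  have hidx : (powMonoidHom 2 : ClassGroup (OrderCl.QO hF.negDiscr) →* ClassGroup (OrderCl.QO hF.negDiscr)).range.index = 2 := by
    have h : hF.negDiscr.D = -4 * ((2 * q : ℕ) : ℤ) := by rw [hF.negDiscr_D, hdF]; push_cast; ring
    rw [index_range_sq_classGroup_QO hF.negDiscr hD4, h, assignedCharCount_neg_four_mul_of_mod_four_eq_two (n := 2 * q) (by omega),
      Nat.primeFactors_mul (by norm_num) hq.ne_zero, Nat.prime_two.primeFactors, hq.primeFactors, ← Finset.insert_eq,
      Finset.card_pair (by omega : 2 ≠ q)]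
    norm_num
  rw [hcard, ← Subgroup.card_mul_index (powMonoidHom 2 : _ →* ClassGroup (OrderCl.QO hF.negDiscr)).range, hidx]
  exact even_two.mul_left _

variable {K : Type} [Field K] [NumberField K] (ι : K →+* ℂ)

-- One decidability world for the point groups over `K[1]` and `ℚ⟮s⟯` (as in A″'s `…SevenModEightPartner`); file-local.
attribute [local instance 2000] Classical.propDecidable

/-- **The `χ_p` partner point (hypotheses (H3ₚ)–(H4ₚ) of the quarter-trace assembly, discharged).** For `s ∈ K[1]`, `s² = −2q` (`q` an odd
prime with `(q/7) = −1`): with `K₂ = ℚ⟮s⟯ ⊂ K[1]` there are a Heegner datum `H₂` and a Heegner point `P₂ ∈ X₀(49)(K₂)` over `Σ_Q φ(τ_Q)` such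
that `Y₂ := P₂ ∈ X₀(49)(K[1])` is fixed by every `ℚ`-algebra map of `K[1]` fixing `s` and satisfies **`Y₂ + tY₂ = O`** for every one with
`t s = −s` (Birch's relation with `h(−8q)` EVEN). Inputs BY NAME: `w(49a1) = +1` (`hw`), (T-φ0) (`h0`). [cite: Gross1984, §5 (5.2)–(5.3)]
[cite: GrossLMS1991, Prop. 5.3] [cite: Darmon2004, Thm. 3.6 and Prop. 3.11] [cite: Cox2013, §3.B Thm. 3.15] -/
theorem exists_partnerPoint_negTwoMulPrime [NumberField (ringClassField K ι 1)] (hw : cm7.rootNumber = 1) {q : ℕ} (hq : q.Prime)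
    (hq2 : q ≠ 2) (hq7 : jacobiSym q 7 = -1) {N : ℕ} [NeZero N] (hN : cm7.conductorNorm ℤ = N) (D₀ : ModularParametrizationData cm7 N)
    (h0 : ∃ h, D₀.cuspZeroPoint = Affine.Point.some 2 (-1) h)
    {s : ringClassField K ι 1} (hs : (s : ℂ) ^ 2 = -(2 * (q : ℂ))) :
    ∃ (H₂ : HeegnerDatum N (NumberField.discr (ℚ⟮s⟯ : IntermediateField ℚ (ringClassField K ι 1))))
      (P₂ : (cm7.baseChange (ℚ⟮s⟯ : IntermediateField ℚ (ringClassField K ι 1))).toAffine.Point),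
      Affine.Point.map ((ringClassField K ι 1).subtype.comp (algebraMap ℚ⟮s⟯ (ringClassField K ι 1))).toRatAlgHom P₂ =
          heegnerPointComplex D₀ H₂ ∧
      (∀ t : ringClassField K ι 1 →ₐ[ℚ] ringClassField K ι 1, t s = s →
        Affine.Point.map t (Affine.Point.map (ℚ⟮s⟯).val P₂) = Affine.Point.map (ℚ⟮s⟯).val P₂) ∧
      (∀ t : ringClassField K ι 1 →ₐ[ℚ] ringClassField K ι 1, t s = -s →
        Affine.Point.map (ℚ⟮s⟯).val P₂ + Affine.Point.map t (Affine.Point.map (ℚ⟮s⟯).val P₂) = 0) := by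
  have hK₂ := isImaginaryQuadratic_adjoin_sqrt_neg_two_mul ι hq hs
  have hH₂ := satisfiesHeegnerHypothesis_adjoin_sqrt_neg_two_mul ι hq hq2 hq7 hs hN
  have hdK₂ := discr_adjoin_sqrt_neg_two_mul ι hq hq2 hs
  obtain ⟨β₂, hβ₂⟩ := exists_dvd_sq_sub_discr_holds N _ hK₂ hH₂
  obtain ⟨H₂, -⟩ := nonempty_heegnerDatum_holds N _ hK₂ hβ₂
  set ι₂ : (ℚ⟮s⟯ : IntermediateField ℚ (ringClassField K ι 1)) →+* ℂ :=
    (ringClassField K ι 1).subtype.comp (algebraMap ℚ⟮s⟯ (ringClassField K ι 1)) with hι₂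
  obtain ⟨P₂, hP₂⟩ := heegnerPointComplex_mem_range_map_holds N cm7 _ hK₂ hH₂ D₀ H₂ ι₂
  have heven : Even H₂.reps.card := even_card_reps_of_discr_negEightPrime hK₂ hq hq2 hdK₂ hH₂ D₀ H₂ ι₂
  refine ⟨H₂, P₂, hP₂, fun t ht ↦ ?_, fun t ht ↦ ?_⟩
  · rw [Affine.Point.map_map, algHom_comp_val_eq_of_apply_eq ι t ht]
  · -- the non-trivial automorphism `c` of `K₂`, `c s = −s`
    have hθ : (⟨s, IntermediateField.mem_adjoin_simple_self ℚ s⟩ : ℚ⟮s⟯) ∉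
        Set.range (algebraMap ℚ (ℚ⟮s⟯ : IntermediateField ℚ (ringClassField K ι 1))) := by
      rintro ⟨a, ha⟩
      have h5 : a ^ 2 = -(2 * (q : ℚ)) := by
        apply (algebraMap ℚ (ℚ⟮s⟯ : IntermediateField ℚ (ringClassField K ι 1))).injective
        rw [map_pow, ha]
        exact adjoinGen_sq_neg_two_mul ι hs
      have : (0 : ℚ) < q := by exact_mod_cast hq.pos
      nlinarith [sq_nonneg a]
    have hc2 := adjoinGen_sq_neg_two_mul ι hs
    set c := Literature.NumberTheory.QuadraticFields.Quadratic.conj (finrank_adjoin_sqrt_neg_two_mul ι hq hs) hθ hc2 with hc_def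
    have hcr : c ⟨s, IntermediateField.mem_adjoin_simple_self ℚ s⟩ = -⟨s, IntermediateField.mem_adjoin_simple_self ℚ s⟩ :=
      Literature.NumberTheory.QuadraticFields.Quadratic.conj_gen _ hθ hc2
    have hcne : c ≠ AlgHom.id ℚ _ := by
      intro h
      have h1 := congrArg (fun f : (ℚ⟮s⟯ : IntermediateField ℚ (ringClassField K ι 1)) →ₐ[ℚ] ℚ⟮s⟯ ↦
        f ⟨s, IntermediateField.mem_adjoin_simple_self ℚ s⟩) h
      simp only [AlgHom.id_apply] at h1
      rw [h1] at hcr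
      have h2 : (⟨s, IntermediateField.mem_adjoin_simple_self ℚ s⟩ : ℚ⟮s⟯) = 0 := by
        have h2' := add_eq_zero_iff_eq_neg.mpr hcr
        rw [← two_mul] at h2'
        exact (mul_eq_zero.mp h2').resolve_left two_ne_zero
      have h3 := adjoinGen_sq_neg_two_mul ι hs
      rw [h2, zero_pow two_ne_zero, map_neg, map_mul, map_natCast, map_ofNat] at h3
      have : (q : (ℚ⟮s⟯ : IntermediateField ℚ (ringClassField K ι 1))) ≠ 0 := by exact_mod_cast hq.ne_zero
      exact this (by have := neg_eq_zero.mp h3.symm; exact (mul_eq_zero.mp this).resolve_left two_ne_zero)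
    -- Birch: `ι₂(cP₂ + P₂) = h • φ(0) = h • T = O`
    have hB := map_cm7_heegnerPoint_conj_add_eq_card_smul hK₂ hN hH₂ D₀ hw H₂ ι₂ hP₂ hcne
    obtain ⟨h0', hh⟩ := h0
    have hzero : H₂.reps.card • D₀.cuspZeroPoint = 0 := by
      obtain ⟨k, hk⟩ := heven
      rw [hh, hk, ← two_mul, mul_nsmul, two_nsmul, cm7_twoTorsion_add_self ℂ, nsmul_zero]
    rw [hzero, ← map_zero (Affine.Point.map (W' := cm7) ι₂.toRatAlgHom)] at hB
    have hB' : Affine.Point.map (W' := cm7) c P₂ + P₂ = 0 := Affine.Point.map_injective (f := ι₂.toRatAlgHom) hB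
    have hmm : Affine.Point.map (W' := cm7) (ℚ⟮s⟯).val (Affine.Point.map (W' := cm7) c P₂) =
        Affine.Point.map (W' := cm7) ((ℚ⟮s⟯).val.comp c) P₂ := by
      cases P₂ <;> rfl
    have hB'' := congrArg (Affine.Point.map (W' := cm7) (ℚ⟮s⟯).val) hB'
    rw [map_add, hmm, map_zero] at hB''
    rw [Affine.Point.map_map, algHom_comp_val_eq_of_apply_eq_neg ι t ht c hcr, add_comm]
    exact hB''

end Partner

end Summit.BirchSwinnertonDyer.BirchSwinnertonDyer.Theorems.GoldfeldGoodTwists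

end
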